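import Mathlib
import HarnessLib
import Literature.NumberTheory.LFunctions.VinogradovMeanValueCount

/-!
# Vinogradov's mean value theorem, IV: Linnik's lemma (Ivić, Lemma 6.1)

Topic `Literature/NumberTheory/LFunctions`. Everything in this file is PROVED (no named facts).

This is the counting lemma for the "first class" of solutions in the proof of the recurrent
inequality for Vinogradov's integral `J_{k,n}(P)` (Ivić, *The Riemann Zeta-Function* (1985),
§6.2, Lemma 6.2; the counting function is `Literature.NumberTheory.LFunctions.VMV.J` of
`VinogradovMeanValueCount.lean`, the set-up of the proof of Lemma 6.2 is
`VinogradovMeanValueStepA.lean`):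

**Lemma 6.1 (Linnik).** Let `m ≥ 1`, `p > n` a prime, `A ∈ ℤ` and `μ₁, …, μ_n ∈ ℤ`. The number `T`
of solutions of the system of congruences

  `x₁^j + ⋯ + x_n^j ≡ μ_j (mod p^j)`  (`1 ≤ j ≤ n`),

in integers `A ≤ x_r ≤ A + m pⁿ − 1` with `x_i ≢ x_j (mod p)` for `i ≠ j`, satisfies
`T ≤ n! mⁿ p^{n(n−1)/2}` (`VMV.linnik_lemma`).

## Proof (Ivić, pp. 147–148, organised by levels)

For `1 ≤ ℓ ≤ n` let `S_ℓ` (`VMV.linnikLevel n p μ ℓ`) be the set of `z ∈ [0, p^ℓ)ⁿ`, pairwise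
incongruent mod `p`, with `p^{min(j, ℓ)} ∣ ∑_r z_r^j − μ_j` for all `1 ≤ j ≤ n`.
* `|S₁| ≤ n!` (`card_linnikLevel_one_le`): modulo `p` the power sums `∑ z_r^j`, `j ≤ n < p`,
  determine the elementary symmetric functions (Newton's identities, the `j ≤ n` being invertible
  in `ℤ/p`), hence the polynomial `∏ (X − z_r)`, hence the set `{z_r mod p}`; so all solutions are
  permutations of one of them.
* `|S_{ℓ+1}| ≤ p^ℓ |S_ℓ|` for `1 ≤ ℓ < n` (`card_linnikLevel_succ_le`): writing `z = a + p^ℓ b`,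
  `a ∈ S_ℓ`, `b ∈ [0, p)ⁿ`, the congruences of degree `j = ℓ+1, …, n` become the `n − ℓ` linear
  congruences `∑_r j a_r^{j−1} b_r ≡ ν_j (mod p)`; choosing `n − ℓ` indices `r` with `a_r ≢ 0`
  (possible as the `a_r` are distinct mod `p` and `ℓ ≥ 1`), the corresponding square system is a
  Vandermonde system in distinct nonzero nodes, so `b` is determined by its remaining `ℓ`
  coordinates.
* `T ≤ mⁿ |S_n|` (reduction mod `pⁿ`), and `|S_n| ≤ n! p^{1 + 2 + ⋯ + (n−1)}`.

## References

* A. Ivić, *The Riemann Zeta-Function*, John Wiley & Sons 1985 (Dover 2003), §6.2, Lemma 6.1,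
  pp. 147–148. [cite: Ivic1985, Lemma 6.1]
* Yu. V. Linnik, *On Weyl's sums*, Mat. Sbornik 12 (1943), 28–39 (the original lemma).
-/

noncomputable section

open Finset

namespace Literature.NumberTheory.LFunctions
namespace VMV

/-! ### Newton's identities over a field in which `1, …, K` are invertible -/

/-- Power sums of a tuple as evaluations of `MvPolynomial.psum`. [folklore] -/
theorem aeval_psum_eq_field {F : Type*} [Field F] {K : ℕ} (f : Fin K → F) (n : ℕ) :
    MvPolynomial.aeval f (MvPolynomial.psum (Fin K) F n) = ∑ i, f i ^ n := by
  simp [MvPolynomial.psum, map_sum, map_pow, MvPolynomial.aeval_X]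

/-- **Newton**: over a field in which `1, 2, …, K` are nonzero, equal power sums `p_1, …, p_K` of
two `K`-tuples give equal elementary symmetric functions `e_0, …, e_K`.
[cite: Ivic1985, Lemma 6.1 (proof: "`s_1, …, s_n` are uniquely determined mod `p` by `μ_1, …, μ_n`")] -/
theorem esymm_eq_of_powerSum_eq_field {F : Type*} [Field F] {K : ℕ}
    (hK : ∀ j : ℕ, 1 ≤ j → j ≤ K → (j : F) ≠ 0) (x y : Fin K → F)
    (h : ∀ j, 1 ≤ j → j ≤ K → ∑ i, x i ^ j = ∑ i, y i ^ j) :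
    ∀ j, j ≤ K → (univ.val.map x).esymm j = (univ.val.map y).esymm j := by
  intro j
  induction j using Nat.strong_induction_on with
  | _ j ih =>
    intro hjK
    rcases Nat.eq_zero_or_pos j with hj0 | hjpos
    · subst hj0
      simp [Multiset.esymm, Multiset.powersetCard_zero_left]
    have newton := MvPolynomial.mul_esymm_eq_sum (Fin K) F j
    have hx := congrArg (MvPolynomial.aeval x) newton
    have hy := congrArg (MvPolynomial.aeval y) newton
    simp only [map_mul, map_natCast, map_pow, map_neg, map_one, map_sum,
      MvPolynomial.aeval_esymm_eq_multiset_esymm, aeval_psum_eq_field] at hx hy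
    have hsum : ∑ a ∈ (antidiagonal j).filter (fun a => a.1 < j),
          (-1 : F) ^ a.1 * (univ.val.map x).esymm a.1 * ∑ i, x i ^ a.2
        = ∑ a ∈ (antidiagonal j).filter (fun a => a.1 < j),
          (-1 : F) ^ a.1 * (univ.val.map y).esymm a.1 * ∑ i, y i ^ a.2 := by
      refine Finset.sum_congr rfl fun a ha => ?_
      rw [Finset.mem_filter, Finset.HasAntidiagonal.mem_antidiagonal] at ha
      rw [ih a.1 ha.2 (by omega), h a.2 (by omega) (by omega)]
    have hj : (j : F) ≠ 0 := hK j hjpos hjK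
    have := hx.trans (hsum ▸ hy.symm)
    exact mul_left_cancel₀ hj this

/-- Equal power sums `p_1, …, p_K` force equal multisets of values, over a field in which
`1, …, K` are nonzero (Newton and Vieta). [folklore] -/
theorem multiset_eq_of_powerSum_eq_field {F : Type*} [Field F] {K : ℕ}
    (hK : ∀ j : ℕ, 1 ≤ j → j ≤ K → (j : F) ≠ 0) (x y : Fin K → F)
    (h : ∀ j, 1 ≤ j → j ≤ K → ∑ i, x i ^ j = ∑ i, y i ^ j) :
    univ.val.map x = univ.val.map y := by
  have he := esymm_eq_of_powerSum_eq_field hK x y h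
  have hcx : Multiset.card (univ.val.map x) = K := by simp
  have hcy : Multiset.card (univ.val.map y) = K := by simp
  have hprod : ((univ.val.map x).map fun t => Polynomial.X - Polynomial.C t).prod
      = ((univ.val.map y).map fun t => Polynomial.X - Polynomial.C t).prod := by
    rw [Multiset.prod_X_sub_X_eq_sum_esymm, Multiset.prod_X_sub_X_eq_sum_esymm, hcx, hcy]
    refine Finset.sum_congr rfl fun j hj => ?_
    rw [Finset.mem_range] at hj
    rw [he j (by omega)]
  have := congrArg Polynomial.roots hprod
  rwa [Polynomial.roots_multiset_prod_X_sub_C, Polynomial.roots_multiset_prod_X_sub_C] at this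

/-! ### The level sets `S_ℓ` -/

/-- The level set `S_ℓ`: tuples `z ∈ [0, p^ℓ)ⁿ`, pairwise incongruent mod `p`, with
`p^{min(j, ℓ)} ∣ ∑_r z_r^j − μ_j` for `1 ≤ j ≤ n` (the digits `x_{r,1} + ⋯ + p^{ℓ-1} x_{r,ℓ}` of the
solutions in Ivić's proof). [cite: Ivic1985, Lemma 6.1 (proof)] -/
def linnikLevel (n p : ℕ) (μ : Fin n → ℤ) (ℓ : ℕ) : Finset (Fin n → ℤ) :=
  (tuples n (Finset.Ico (0 : ℤ) ((p : ℤ) ^ ℓ))).filter (fun z =>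
    (∀ i i' : Fin n, i ≠ i' → ¬ ((p : ℤ) ∣ z i - z i')) ∧
      ∀ j : Fin n, (p : ℤ) ^ (min (j.val + 1) ℓ) ∣ (∑ r, z r ^ (j.val + 1)) - μ j)

/-- Membership in `S_ℓ`, unfolded. [folklore] -/
theorem mem_linnikLevel {n p : ℕ} {μ : Fin n → ℤ} {ℓ : ℕ} {z : Fin n → ℤ} :
    z ∈ linnikLevel n p μ ℓ ↔
      (∀ r, 0 ≤ z r ∧ z r < (p : ℤ) ^ ℓ) ∧ (∀ i i' : Fin n, i ≠ i' → ¬ ((p : ℤ) ∣ z i - z i')) ∧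
        ∀ j : Fin n, (p : ℤ) ^ (min (j.val + 1) ℓ) ∣ (∑ r, z r ^ (j.val + 1)) - μ j := by
  unfold linnikLevel
  rw [mem_filter, mem_tuples]
  simp only [Finset.mem_Ico]

/-- Elements of `S_ℓ` (`ℓ ≥ 1`) are injective as maps `Fin n → ℤ`. [folklore] -/
theorem injective_of_mem_linnikLevel {n p : ℕ} {μ : Fin n → ℤ} {ℓ : ℕ} {z : Fin n → ℤ}
    (hz : z ∈ linnikLevel n p μ ℓ) : Function.Injective z := by
  intro i i' h
  by_contra hne
  exact (mem_linnikLevel.1 hz).2.1 i i' hne (by rw [h, sub_self]; exact dvd_zero _)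

/-- Elements of `S_ℓ` are injective modulo `p`. [folklore] -/
theorem injective_cast_of_mem_linnikLevel {n p : ℕ} {μ : Fin n → ℤ} {ℓ : ℕ} {z : Fin n → ℤ}
    (hz : z ∈ linnikLevel n p μ ℓ) : Function.Injective (fun r => ((z r : ℤ) : ZMod p)) := by
  intro i i' h
  by_contra hne
  have h' : ((z i : ℤ) : ZMod p) = ((z i' : ℤ) : ZMod p) := h
  rw [ZMod.intCast_eq_intCast_iff_dvd_sub] at h'
  exact (mem_linnikLevel.1 hz).2.1 i' i (Ne.symm hne) h'

/-! ### Level one: at most `n!` solutions modulo `p` -/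

/-- In `S₁` the power sums are prescribed modulo `p`: `∑_r z_r^j ≡ μ_j (mod p)` for `1 ≤ j ≤ n`.
[folklore] -/
theorem powerSum_cast_eq_of_mem_linnikLevel_one {n p : ℕ} {μ : Fin n → ℤ} {z : Fin n → ℤ}
    (hz : z ∈ linnikLevel n p μ 1) (j : ℕ) (hj1 : 1 ≤ j) (hjn : j ≤ n) :
    ∑ r, (((z r : ℤ) : ZMod p)) ^ j = ((μ ⟨j - 1, by omega⟩ : ℤ) : ZMod p) := by
  have h := (mem_linnikLevel.1 hz).2.2 ⟨j - 1, by omega⟩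
  simp only at h
  rw [show j - 1 + 1 = j by omega, show min j 1 = 1 by omega, pow_one] at h
  have h2 : (((∑ r, z r ^ j) - μ ⟨j - 1, by omega⟩ : ℤ) : ZMod p) = 0 :=
    (ZMod.intCast_zmod_eq_zero_iff_dvd _ _).2 h
  push_cast at h2
  exact sub_eq_zero.1 h2

/-- **Level one** (Ivić: "`T₁ ≤ n!`"): for a prime `p > n`, `|S₁| ≤ n!`. All solutions are
permutations of a fixed one, because modulo `p` the power sums determine the set of values
(Newton's identities with `1, …, n` invertible mod `p`). [cite: Ivic1985, Lemma 6.1 (proof)] -/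
theorem card_linnikLevel_one_le {n p : ℕ} (hp : p.Prime) (hnp : n < p) (μ : Fin n → ℤ) :
    (linnikLevel n p μ 1).card ≤ Nat.factorial n := by
  classical
  haveI : Fact p.Prime := ⟨hp⟩
  rcases (linnikLevel n p μ 1).eq_empty_or_nonempty with h0 | ⟨z₀, hz₀⟩
  · rw [h0, card_empty]; exact Nat.zero_le _
  -- `1, …, n` are nonzero in `ZMod p`
  have hK : ∀ j : ℕ, 1 ≤ j → j ≤ n → (j : ZMod p) ≠ 0 := by
    intro j hj1 hjn h
    rw [ZMod.natCast_eq_zero_iff] at h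
    exact absurd (Nat.le_of_dvd (by omega) h) (by omega)
  have hp0 : (0 : ℤ) < p := by exact_mod_cast hp.pos
  -- every solution is `z₀ ∘ σ`
  have key : ∀ z ∈ linnikLevel n p μ 1, ∃ σ : Equiv.Perm (Fin n), z = z₀ ∘ σ := by
    intro z hz
    have hms : univ.val.map (fun r => ((z r : ℤ) : ZMod p)) =
        univ.val.map (fun r => ((z₀ r : ℤ) : ZMod p)) := by
      refine multiset_eq_of_powerSum_eq_field hK _ _ fun j hj1 hjn => ?_
      rw [powerSum_cast_eq_of_mem_linnikLevel_one hz j hj1 hjn,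
        powerSum_cast_eq_of_mem_linnikLevel_one hz₀ j hj1 hjn]
    -- values of `z` are values of `z₀`
    have hval : ∀ r, ∃ r', z r = z₀ r' := by
      intro r
      have hmem : ((z r : ℤ) : ZMod p) ∈ univ.val.map (fun r => ((z₀ r : ℤ) : ZMod p)) := by
        rw [← hms]; exact Multiset.mem_map.2 ⟨r, mem_univ_val r, rfl⟩
      obtain ⟨r', -, hr'⟩ := Multiset.mem_map.1 hmem
      refine ⟨r', ?_⟩
      have h1 := (mem_linnikLevel.1 hz).1 r
      have h2 := (mem_linnikLevel.1 hz₀).1 r'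
      rw [pow_one] at h1 h2
      have h3 : z₀ r' % p = z r % p := (ZMod.intCast_eq_intCast_iff' _ _ _).1 hr'
      rw [Int.emod_eq_of_lt h1.1 h1.2, Int.emod_eq_of_lt h2.1 h2.2] at h3
      exact h3.symm
    choose g hg using hval
    have hginj : Function.Injective g := by
      intro i i' h
      apply injective_of_mem_linnikLevel hz
      rw [hg i, hg i', h]
    have hgbij : Function.Bijective g := Finite.injective_iff_bijective.1 hginj
    refine ⟨Equiv.ofBijective g hgbij, ?_⟩
    funext r
    simp [hg r]
  calc (linnikLevel n p μ 1).card
      ≤ ((univ : Finset (Equiv.Perm (Fin n))).image (fun σ : Equiv.Perm (Fin n) => z₀ ∘ ⇑σ)).card := by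
        refine card_le_card fun z hz => ?_
        obtain ⟨σ, hσ⟩ := key z hz
        exact mem_image.2 ⟨σ, mem_univ _, hσ.symm⟩
    _ ≤ (univ : Finset (Equiv.Perm (Fin n))).card := card_image_le
    _ = Nat.factorial n := by rw [card_univ, Fintype.card_perm, Fintype.card_fin]

/-! ### Reduction modulo `p^ℓ` -/

/-- Powers of congruent numbers are congruent: `q ∣ a − b → q ∣ a^m − b^m`. [folklore] -/
theorem dvd_pow_sub_pow_of_dvd_sub {q a b : ℤ} (h : q ∣ a - b) (m : ℕ) : q ∣ a ^ m - b ^ m :=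
  dvd_trans h (sub_dvd_pow_sub_pow a b m)

/-- Power sums of coordinatewise congruent tuples are congruent. [folklore] -/
theorem dvd_sum_pow_sub_sum_pow {n : ℕ} {q : ℤ} {z z' : Fin n → ℤ} (h : ∀ r, q ∣ z r - z' r)
    (m : ℕ) : q ∣ (∑ r, z r ^ m) - ∑ r, z' r ^ m := by
  rw [← Finset.sum_sub_distrib]
  exact Finset.dvd_sum fun r _ => dvd_pow_sub_pow_of_dvd_sub (h r) m

/-- `z % q ≡ z (mod q)` in divisibility form. [folklore] -/
theorem dvd_emod_sub_self (q z : ℤ) : q ∣ z % q - z := by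
  have := Int.emod_add_mul_ediv z q
  exact ⟨-(z / q), by linarith⟩

/-- **Reduction.** For `ℓ ≥ 1`, reducing modulo `p^ℓ` the coordinates of a tuple that is
pairwise incongruent mod `p` and satisfies the congruences with moduli `p^{min(j, ℓ')}`, `ℓ ≤ ℓ'`,
gives an element of `S_ℓ` (used for `z ∈ S_{ℓ+1}`, and for the original solutions with
`ℓ = ℓ' = n`). [cite: Ivic1985, Lemma 6.1 (proof)] -/
theorem reduce_mem_linnikLevel {n p : ℕ} (hp : p.Prime) {μ : Fin n → ℤ} {ℓ ℓ' : ℕ} (hℓ : 1 ≤ ℓ)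
    (hℓℓ' : ℓ ≤ ℓ') {z : Fin n → ℤ} (hinc : ∀ i i' : Fin n, i ≠ i' → ¬ ((p : ℤ) ∣ z i - z i'))
    (hcong : ∀ j : Fin n, (p : ℤ) ^ (min (j.val + 1) ℓ') ∣ (∑ r, z r ^ (j.val + 1)) - μ j) :
    (fun r => z r % (p : ℤ) ^ ℓ) ∈ linnikLevel n p μ ℓ := by
  have hp0 : (0 : ℤ) < p := by exact_mod_cast hp.pos
  have hq0 : (0 : ℤ) < (p : ℤ) ^ ℓ := pow_pos hp0 _
  have hpq : (p : ℤ) ∣ (p : ℤ) ^ ℓ := dvd_pow_self _ (by omega)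
  refine mem_linnikLevel.2 ⟨fun r => ⟨Int.emod_nonneg _ hq0.ne', Int.emod_lt_of_pos _ hq0⟩, ?_, ?_⟩
  · intro i i' hii' h
    apply hinc i i' hii'
    have h1 : (p : ℤ) ∣ z i % (p : ℤ) ^ ℓ - z i := dvd_trans hpq (dvd_emod_sub_self _ _)
    have h2 : (p : ℤ) ∣ z i' % (p : ℤ) ^ ℓ - z i' := dvd_trans hpq (dvd_emod_sub_self _ _)
    have : z i - z i' = (z i % (p : ℤ) ^ ℓ - z i' % (p : ℤ) ^ ℓ) - (z i % (p : ℤ) ^ ℓ - z i)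
        + (z i' % (p : ℤ) ^ ℓ - z i') := by ring
    rw [this]
    exact (h.sub h1).add h2
  · intro j
    have h1 : (p : ℤ) ^ (min (j.val + 1) ℓ) ∣
        (∑ r, (z r % (p : ℤ) ^ ℓ) ^ (j.val + 1)) - ∑ r, z r ^ (j.val + 1) :=
      dvd_trans (pow_dvd_pow _ (min_le_right _ _))
        (dvd_sum_pow_sub_sum_pow (fun r => dvd_emod_sub_self _ _) _)
    have h2 : (p : ℤ) ^ (min (j.val + 1) ℓ) ∣ (∑ r, z r ^ (j.val + 1)) - μ j :=
      dvd_trans (pow_dvd_pow _ (min_le_min_left _ hℓℓ')) (hcong j)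
    have := h1.add h2
    rwa [sub_add_sub_cancel] at this

/-! ### The level step: `|S_{ℓ+1}| ≤ p^ℓ |S_ℓ|` -/

/-- In a half-open interval of length `m q` each residue class modulo `q` has at most `m`
elements. [folklore] -/
theorem card_filter_Ico_emod_le {q : ℤ} (hq : 0 < q) (A c : ℤ) (m : ℕ) :
    ((Finset.Ico A (A + m * q)).filter (fun t => t % q = c)).card ≤ m := by
  have key : Set.InjOn (fun t : ℤ => (t - A) / q)
      ((Finset.Ico A (A + m * q)).filter (fun t => t % q = c)) := by
    intro t ht t' ht' h
    simp only [coe_filter, Set.mem_setOf_eq] at ht ht'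
    have hmod : (t - A) % q = (t' - A) % q := by
      rw [Int.sub_emod, Int.sub_emod t', ht.2, ht'.2]
    have e1 := Int.emod_add_mul_ediv (t - A) q
    have e2 := Int.emod_add_mul_ediv (t' - A) q
    have h' : (t - A) / q = (t' - A) / q := h
    rw [hmod, h'] at e1
    linarith [e1, e2]
  calc ((Finset.Ico A (A + m * q)).filter (fun t => t % q = c)).card
      ≤ (Finset.Ico (0 : ℤ) m).card := by
        refine card_le_card_of_injOn (fun t : ℤ => (t - A) / q) (fun t ht => ?_) key
        rw [coe_filter, Set.mem_setOf_eq, Finset.mem_Ico] at ht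
        rw [coe_Ico, Set.mem_Ico]
        exact ⟨Int.ediv_nonneg (by linarith [ht.1.1]) hq.le,
          Int.ediv_lt_of_lt_mul hq (by linarith [ht.1.2])⟩
    _ = m := by simp

/-- **The linear step** (Ivić: "`T₂ = p`, `T₃ = p²`, …"): for `1 ≤ ℓ < n`, a prime `p > n` and
`a ∈ S_ℓ`, at most `p^ℓ` elements of `S_{ℓ+1}` reduce to `a` modulo `p^ℓ`. Writing `z = a + p^ℓ b`
(`0 ≤ b_r < p`), two such `z` with the same `b_r` off a set `R'` of `n − ℓ` indices where
`a_r ≢ 0 (mod p)` coincide: the differences `d_r` satisfy the Vandermonde system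
`∑_{r ∈ R'} a_r^{ℓ+i} d_r ≡ 0 (mod p)`, `0 ≤ i < n − ℓ`, in the distinct nonzero nodes `a_r mod p`.
[cite: Ivic1985, Lemma 6.1 (proof)] -/
theorem card_fibre_linnikLevel_le {n p : ℕ} (hp : p.Prime) (hnp : n < p) {μ : Fin n → ℤ} {ℓ : ℕ}
    (hℓ : 1 ≤ ℓ) (hℓn : ℓ < n) {a : Fin n → ℤ} (ha : a ∈ linnikLevel n p μ ℓ) :
    ((linnikLevel n p μ (ℓ + 1)).filter (fun z => (fun r => z r % (p : ℤ) ^ ℓ) = a)).card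
      ≤ p ^ ℓ := by
  classical
  haveI : Fact p.Prime := ⟨hp⟩
  have hp0 : (0 : ℤ) < p := by exact_mod_cast hp.pos
  set q : ℤ := (p : ℤ) ^ ℓ with hq
  have hq0 : 0 < q := pow_pos hp0 _
  -- the nodes `ā_r = a_r mod p`, injective
  set abar : Fin n → ZMod p := fun r => ((a r : ℤ) : ZMod p) with habar
  have habar_inj : Function.Injective abar := injective_cast_of_mem_linnikLevel ha
  -- choose `R'`: `n - ℓ` indices with `ā_r ≠ 0`
  set G : Finset (Fin n) := univ.filter (fun r => abar r ≠ 0) with hG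
  have hGcard : n - 1 ≤ G.card := by
    have h1 : (univ.filter (fun r => abar r = 0)).card ≤ 1 := by
      refine card_le_one.2 fun i hi i' hi' => ?_
      rw [mem_filter] at hi hi'
      exact habar_inj (hi.2.trans hi'.2.symm)
    have h2 := card_filter_add_card_filter_not (s := (univ : Finset (Fin n)))
      (fun r => abar r = 0)
    rw [card_univ, Fintype.card_fin] at h2
    have h3 : (univ.filter (fun r => ¬ abar r = 0)) = G := by rw [hG]
    rw [h3] at h2
    omega
  obtain ⟨R', hR'G, hR'card⟩ := Finset.exists_subset_card_eq (s := G) (n := n - ℓ) (by omega)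
  have hR'ne : ∀ r ∈ R', abar r ≠ 0 := fun r hr => (mem_filter.1 (hR'G hr)).2
  -- the map `z ↦ (b_r)_{r ∉ R'}`
  set φ : (Fin n → ℤ) → (Fin n → ℤ) := fun z r => if r ∈ R' then 0 else z r / q with hφ
  set Fib := (linnikLevel n p μ (ℓ + 1)).filter (fun z => (fun r => z r % (p : ℤ) ^ ℓ) = a)
    with hFib
  -- basic facts about elements of the fibre
  have hdecomp : ∀ z ∈ Fib, ∀ r, z r = a r + q * (z r / q) := by
    intro z hz r
    rw [hFib, mem_filter] at hz
    have h1 : z r % q = a r := by rw [hq]; exact congr_fun hz.2 r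
    have := Int.emod_add_mul_ediv (z r) q
    rw [h1] at this
    exact this.symm
  have hbrange : ∀ z ∈ Fib, ∀ r, 0 ≤ z r / q ∧ z r / q < p := by
    intro z hz r
    rw [hFib, mem_filter] at hz
    have h1 := (mem_linnikLevel.1 hz.1).1 r
    refine ⟨Int.ediv_nonneg h1.1 hq0.le, Int.ediv_lt_of_lt_mul hq0 ?_⟩
    rw [hq, ← pow_succ']; exact h1.2
  -- the target box
  set Box : Finset (Fin n → ℤ) :=
    Fintype.piFinset (fun r => if r ∈ R' then ({0} : Finset ℤ) else Finset.Ico (0 : ℤ) p) with hBox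
  have hBoxcard : Box.card = p ^ ℓ := by
    rw [hBox, Fintype.card_piFinset]
    have h1 : ∀ r : Fin n, (if r ∈ R' then ({0} : Finset ℤ) else Finset.Ico (0 : ℤ) p).card
        = if r ∈ R' then 1 else p := by
      intro r; split_ifs <;> simp
    simp_rw [h1]
    rw [Finset.prod_ite, prod_const_one, one_mul, prod_const]
    congr 1
    have : (univ.filter (fun r : Fin n => r ∉ R')) = R'ᶜ := by
      ext r; simp [Finset.mem_compl]
    rw [this, Finset.card_compl, Fintype.card_fin, hR'card]
    omega
  have hmaps : ∀ z ∈ Fib, φ z ∈ Box := by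
    intro z hz
    rw [hBox, Fintype.mem_piFinset]
    intro r
    by_cases hr : r ∈ R'
    · simp [hφ, hr]
    · simp only [hφ, hr, if_false, Finset.mem_Ico]
      exact hbrange z hz r
  -- injectivity on the fibre
  have hinj : Set.InjOn φ Fib := by
    intro z hz z' hz' hφeq
    rw [Finset.mem_coe] at hz hz'
    set d : Fin n → ℤ := fun r => z r / q - z' r / q with hd
    -- off `R'` the quotients agree
    have hoff : ∀ r, r ∉ R' → d r = 0 := by
      intro r hr
      have := congr_fun hφeq r
      simp only [hφ, hr, if_false] at this
      simp [hd, this]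
    -- the linear congruences: `p ∣ ∑_r m a_r^{m-1} d_r` for `ℓ + 1 ≤ m ≤ n`
    have hlin : ∀ m : ℕ, ℓ + 1 ≤ m → m ≤ n →
        ∑ r, ((m : ZMod p) * abar r ^ (m - 1) * ((d r : ℤ) : ZMod p)) = 0 := by
      intro m hm1 hmn
      have hzm := hz
      have hz'm := hz'
      rw [hFib, mem_filter] at hzm hz'm
      have hc := (mem_linnikLevel.1 hzm.1).2.2 ⟨m - 1, by omega⟩
      have hc' := (mem_linnikLevel.1 hz'm.1).2.2 ⟨m - 1, by omega⟩
      simp only at hc hc'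
      rw [show m - 1 + 1 = m by omega, show min m (ℓ + 1) = ℓ + 1 by omega] at hc hc'
      -- `p^{ℓ+1} ∣ ∑ (z_r^m - z'_r^m)`
      have hdiff : (p : ℤ) ^ (ℓ + 1) ∣ (∑ r, z r ^ m) - ∑ r, z' r ^ m := by
        have := hc.sub hc'; rwa [sub_sub_sub_cancel_right] at this
      -- Taylor to first order modulo `p^{ℓ+1}`
      have hpq2 : (p : ℤ) ^ (ℓ + 1) ∣ q ^ 2 := by
        rw [hq, ← pow_mul]; exact pow_dvd_pow _ (by omega)
      have htaylor : ∀ w ∈ Fib, (p : ℤ) ^ (ℓ + 1) ∣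
          (∑ r, w r ^ m) - ∑ r, (a r ^ m + a r ^ (m - 1) * (q * (w r / q)) * m) := by
        intro w hw
        rw [← Finset.sum_sub_distrib]
        refine Finset.dvd_sum fun r _ => ?_
        have h1 := sq_dvd_add_pow_sub_sub (q * (w r / q)) (a r) m
        rw [← hdecomp w hw r] at h1
        have h2 : (p : ℤ) ^ (ℓ + 1) ∣ (q * (w r / q)) ^ 2 := by
          rw [mul_pow]; exact dvd_mul_of_dvd_left hpq2 _
        have h3 := dvd_trans h2 h1
        have : w r ^ m - (a r ^ m + a r ^ (m - 1) * (q * (w r / q)) * m)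
            = w r ^ m - a r ^ (m - 1) * (q * (w r / q)) * m - a r ^ m := by ring
        rwa [this]
      have h4 : (p : ℤ) ^ (ℓ + 1) ∣ (∑ r, (a r ^ m + a r ^ (m - 1) * (q * (z r / q)) * m))
          - ∑ r, (a r ^ m + a r ^ (m - 1) * (q * (z' r / q)) * m) := by
        have := ((htaylor z hz).sub (htaylor z' hz')).sub hdiff
        have e : ((∑ r, z r ^ m) - ∑ r, (a r ^ m + a r ^ (m - 1) * (q * (z r / q)) * m))
            - ((∑ r, z' r ^ m) - ∑ r, (a r ^ m + a r ^ (m - 1) * (q * (z' r / q)) * m))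
            - ((∑ r, z r ^ m) - ∑ r, z' r ^ m)
            = -((∑ r, (a r ^ m + a r ^ (m - 1) * (q * (z r / q)) * m))
              - ∑ r, (a r ^ m + a r ^ (m - 1) * (q * (z' r / q)) * m)) := by ring
        rw [e] at this
        exact (dvd_neg.1 this)
      have h5 : (∑ r, (a r ^ m + a r ^ (m - 1) * (q * (z r / q)) * m))
          - ∑ r, (a r ^ m + a r ^ (m - 1) * (q * (z' r / q)) * m)
          = q * ∑ r, (m : ℤ) * a r ^ (m - 1) * d r := by
        rw [← Finset.sum_sub_distrib, Finset.mul_sum]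
        refine Finset.sum_congr rfl fun r _ => ?_
        simp only [hd]; ring
      rw [h5, pow_succ] at h4
      have h6 : (p : ℤ) ∣ ∑ r, (m : ℤ) * a r ^ (m - 1) * d r :=
        (mul_dvd_mul_iff_left hq0.ne').1 h4
      have h7 := (ZMod.intCast_zmod_eq_zero_iff_dvd _ p).2 h6
      push_cast at h7
      simpa [habar] using h7
    -- the Vandermonde system for `w_r = ā_r^ℓ d̄_r`
    set w : Fin n → ZMod p := fun r => abar r ^ ℓ * ((d r : ℤ) : ZMod p) with hw
    have hw_off : ∀ r, r ∉ R' → w r = 0 := by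
      intro r hr; simp [hw, hoff r hr]
    have hK : ∀ j : ℕ, 1 ≤ j → j ≤ n → (j : ZMod p) ≠ 0 := by
      intro j hj1 hjn h
      rw [ZMod.natCast_eq_zero_iff] at h
      exact absurd (Nat.le_of_dvd (by omega) h) (by omega)
    have hvan : ∀ i : ℕ, i < n - ℓ → ∑ r, w r * abar r ^ i = 0 := by
      intro i hi
      have h1 := hlin (ℓ + 1 + i) (by omega) (by omega)
      rw [show ℓ + 1 + i - 1 = ℓ + i by omega] at h1
      have h2 : ∑ r, ((ℓ + 1 + i : ℕ) : ZMod p) * abar r ^ (ℓ + i) * ((d r : ℤ) : ZMod p)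
          = ((ℓ + 1 + i : ℕ) : ZMod p) * ∑ r, w r * abar r ^ i := by
        rw [Finset.mul_sum]
        refine Finset.sum_congr rfl fun r _ => ?_
        simp only [hw]; ring
      rw [h2] at h1
      exact (mul_eq_zero.1 h1).resolve_left (hK _ (by omega) (by omega))
    -- enumerate `R'`
    set e : Fin (n - ℓ) ↪o Fin n := R'.orderEmbOfFin hR'card with he
    have hv_inj : Function.Injective (abar ∘ e) := habar_inj.comp e.injective
    have hdet : (Matrix.vandermonde (abar ∘ e)).det ≠ 0 :=
      Matrix.det_vandermonde_ne_zero_iff.2 hv_inj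
    have hvec : Matrix.vecMul (w ∘ e) (Matrix.vandermonde (abar ∘ e)) = 0 := by
      funext j
      rw [Matrix.vecMul, dotProduct]
      simp only [Function.comp, Matrix.vandermonde_apply, Pi.zero_apply]
      have h1 := hvan j.val j.isLt
      have h2 : ∑ r, w r * abar r ^ (j : ℕ) = ∑ r ∈ R', w r * abar r ^ (j : ℕ) := by
        rw [← Finset.sum_subset (Finset.subset_univ R')]
        intro r _ hr
        rw [hw_off r hr, zero_mul]
      rw [h2, ← Finset.map_orderEmbOfFin_univ R' hR'card, Finset.sum_map] at h1
      exact h1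
    have hw0 : w ∘ e = 0 := Matrix.eq_zero_of_vecMul_eq_zero hdet hvec
    -- conclude `d = 0`
    have hd0 : ∀ r, d r = 0 := by
      intro r
      by_cases hr : r ∈ R'
      · have hr' : r ∈ Finset.map e.toEmbedding univ := by
          rw [he, Finset.map_orderEmbOfFin_univ]; exact hr
        obtain ⟨i, -, hi⟩ := Finset.mem_map.1 hr'
        have h1 : w r = 0 := by
          have := congr_fun hw0 i
          simp only [Function.comp, Pi.zero_apply] at this
          rw [← hi]; exact this
        have h2 : ((d r : ℤ) : ZMod p) = 0 := by
          simp only [hw] at h1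
          exact (mul_eq_zero.1 h1).resolve_left (pow_ne_zero _ (hR'ne r hr))
        rw [ZMod.intCast_zmod_eq_zero_iff_dvd] at h2
        refine Int.eq_zero_of_abs_lt_dvd h2 ?_
        have hb1 := hbrange z hz r
        have hb2 := hbrange z' hz' r
        simp only [hd]
        rw [abs_lt]; constructor <;> linarith
      · exact hoff r hr
    funext r
    rw [hdecomp z hz r, hdecomp z' hz' r]
    have := hd0 r
    simp only [hd] at this
    rw [sub_eq_zero.1 this]
  calc Fib.card ≤ Box.card := Finset.card_le_card_of_injOn φ hmaps hinj
    _ = p ^ ℓ := hBoxcard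

/-- **`|S_{ℓ+1}| ≤ p^ℓ |S_ℓ|`** for `1 ≤ ℓ < n`, `p > n` prime. [cite: Ivic1985, Lemma 6.1 (proof)] -/
theorem card_linnikLevel_succ_le {n p : ℕ} (hp : p.Prime) (hnp : n < p) (μ : Fin n → ℤ) {ℓ : ℕ}
    (hℓ : 1 ≤ ℓ) (hℓn : ℓ < n) :
    (linnikLevel n p μ (ℓ + 1)).card ≤ p ^ ℓ * (linnikLevel n p μ ℓ).card := by
  classical
  refine Finset.card_le_mul_card_image_of_maps_to (f := fun z r => z r % (p : ℤ) ^ ℓ)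
    (fun z hz => ?_) (p ^ ℓ) (fun a ha => card_fibre_linnikLevel_le hp hnp hℓ hℓn ha)
  have h := mem_linnikLevel.1 hz
  exact reduce_mem_linnikLevel hp hℓ (Nat.le_succ ℓ) h.2.1 h.2.2

/-- **`|S_ℓ| ≤ n! p^{0 + 1 + ⋯ + (ℓ−1)}`** for `1 ≤ ℓ ≤ n`. [cite: Ivic1985, Lemma 6.1 (proof)] -/
theorem card_linnikLevel_le {n p : ℕ} (hp : p.Prime) (hnp : n < p) (μ : Fin n → ℤ) {ℓ : ℕ}
    (hℓ : 1 ≤ ℓ) (hℓn : ℓ ≤ n) :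
    (linnikLevel n p μ ℓ).card ≤ Nat.factorial n * p ^ (∑ i ∈ Finset.range ℓ, i) := by
  induction ℓ with
  | zero => omega
  | succ ℓ ih =>
    rcases Nat.eq_zero_or_pos ℓ with h0 | hℓpos
    · subst h0
      simpa using card_linnikLevel_one_le hp hnp μ
    · calc (linnikLevel n p μ (ℓ + 1)).card ≤ p ^ ℓ * (linnikLevel n p μ ℓ).card :=
            card_linnikLevel_succ_le hp hnp μ hℓpos (by omega)
        _ ≤ p ^ ℓ * (Nat.factorial n * p ^ (∑ i ∈ Finset.range ℓ, i)) :=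
            Nat.mul_le_mul_left _ (ih hℓpos (by omega))
        _ = Nat.factorial n * p ^ (∑ i ∈ Finset.range (ℓ + 1), i) := by
            rw [Finset.sum_range_succ, pow_add]; ring

/-! ### Linnik's lemma -/

/-- **Ivić, Lemma 6.1 (Linnik's lemma).** Let `p > n` be a prime, `m ∈ ℕ`, `A ∈ ℤ` and
`μ : Fin n → ℤ`. The number of `x ∈ [A, A + m pⁿ)ⁿ` (i.e. `A ≤ x_r ≤ A + m pⁿ − 1`), pairwise
incongruent modulo `p`, with `x₁^j + ⋯ + x_n^j ≡ μ_j (mod p^j)` for `1 ≤ j ≤ n` (the index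
`j : Fin n` standing for the exponent `j + 1`), is at most `n! mⁿ p^{n(n−1)/2}`.
[cite: Ivic1985, Lemma 6.1] -/
theorem linnik_lemma {n p : ℕ} (hp : p.Prime) (hnp : n < p) (m : ℕ) (A : ℤ) (μ : Fin n → ℤ) :
    ((tuples n (Finset.Ico A (A + m * (p : ℤ) ^ n))).filter (fun x =>
        (∀ i i' : Fin n, i ≠ i' → ¬ ((p : ℤ) ∣ x i - x i')) ∧
          ∀ j : Fin n, (p : ℤ) ^ (j.val + 1) ∣ (∑ r, x r ^ (j.val + 1)) - μ j)).card
      ≤ Nat.factorial n * m ^ n * p ^ (n * (n - 1) / 2) := by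
  classical
  rcases Nat.eq_zero_or_pos n with hn0 | hnpos
  · subst hn0
    refine (card_le_card (filter_subset _ _)).trans ?_
    rw [card_tuples]; simp
  have hp0 : (0 : ℤ) < p := by exact_mod_cast hp.pos
  set q : ℤ := (p : ℤ) ^ n with hq
  have hq0 : 0 < q := pow_pos hp0 _
  set Sol := (tuples n (Finset.Ico A (A + m * (p : ℤ) ^ n))).filter (fun x =>
        (∀ i i' : Fin n, i ≠ i' → ¬ ((p : ℤ) ∣ x i - x i')) ∧
          ∀ j : Fin n, (p : ℤ) ^ (j.val + 1) ∣ (∑ r, x r ^ (j.val + 1)) - μ j) with hSol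
  -- reduce modulo `pⁿ` into `S_n`, fibres of size `≤ mⁿ`
  have hmaps : ∀ x ∈ Sol, (fun r => x r % (p : ℤ) ^ n) ∈ linnikLevel n p μ n := by
    intro x hx
    rw [hSol, mem_filter] at hx
    refine reduce_mem_linnikLevel hp hnpos le_rfl hx.2.1 fun j => ?_
    rw [show min (j.val + 1) n = j.val + 1 from min_eq_left (by omega)]
    exact hx.2.2 j
  have hfib : ∀ z ∈ linnikLevel n p μ n,
      (Sol.filter (fun x => (fun r => x r % (p : ℤ) ^ n) = z)).card ≤ m ^ n := by
    intro z _
    calc (Sol.filter (fun x => (fun r => x r % (p : ℤ) ^ n) = z)).card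
        ≤ (Fintype.piFinset fun r =>
            (Finset.Ico A (A + m * q)).filter (fun t => t % q = z r)).card := by
          refine card_le_card fun x hx => ?_
          rw [mem_filter, hSol, mem_filter, mem_tuples] at hx
          rw [Fintype.mem_piFinset]
          intro r
          rw [mem_filter]
          exact ⟨hx.1.1 r, congr_fun hx.2 r⟩
      _ ≤ m ^ n := by
          rw [Fintype.card_piFinset]
          calc ∏ r, ((Finset.Ico A (A + m * q)).filter (fun t => t % q = z r)).card
              ≤ ∏ _r : Fin n, m :=
                Finset.prod_le_prod' fun r _ => card_filter_Ico_emod_le hq0 A (z r) m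
            _ = m ^ n := by rw [prod_const, card_univ, Fintype.card_fin]
  calc Sol.card ≤ m ^ n * (linnikLevel n p μ n).card :=
        Finset.card_le_mul_card_image_of_maps_to hmaps (m ^ n) hfib
    _ ≤ m ^ n * (Nat.factorial n * p ^ (∑ i ∈ Finset.range n, i)) :=
        Nat.mul_le_mul_left _ (card_linnikLevel_le hp hnp μ hnpos le_rfl)
    _ = Nat.factorial n * m ^ n * p ^ (n * (n - 1) / 2) := by
        rw [Finset.sum_range_id]; ring

end VMV
end Literature.NumberTheory.LFunctions
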